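import Summits.QuantumFields.YangMills.Theorems.BalabanUVNodesK0Stub1SectFHTermsMultiplierForm
import HarnessLib

/-!
# K0⁷ STUB 1 (`stub_prop8StepCoP13`), sub-target S4b «the (δ∕δA′)V pieces at objects», brick 7:
# **SECT. F's `W = (δ∕δA′)V` ASSEMBLED AS ONE GRADIENT VECTOR AT THE RECORD's FLAT OPERATORS** — the `H`-groups in the (87)–(88) multiplier form (brick 6)
# PLUS the composed V₀-group `(δ∕δA′)V₀(A′ − HD(A′)) = (1 − 𝔇(A′)*H*)·((δ∕δA)V₀)(A′ − HD(A′))` (p. 291 (90), p. 292) by the chain rule along the chart (47),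
# in k0-s1-w1's (128) currency `⟪δ, Δ_aA′ + W A′⟫ = 0`, with the pointwise (98)-slot of the whole from the printed letters

Cell `pub-ymgap`, width seat `pub-ymgap-k0-s1-w2` g2 (director-ym №197 ∕ HUMAN RULING D-0149; plan g77–g81 W-SEAT-START-LIST §k0-s1, w2 ↦ S4b).
`--kind proof --supports stmt-QuantumFields-20541 --as helper`; count-neutral.  [15] = [Balaban1985Variational]; [B6] = [Balaban1984PropagatorsII].

WHY.  With brick 6 (`K0Stub1SectFHTermsMultiplierForm`: the two `H`-terms of (157) are the block form `½⟪D, MD⟫ − ⟪QA′, MD⟫`, `M = (QGQ*)⁻¹ − a`, gradient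
`𝔇†M(D − QA′) − Q†MD`) the only remaining piece of Sect. F's `V(A′) = −⟨A′, ∂*∂HD(A′)⟩ + ½⟨HD(A′), ∂*∂HD(A′)⟩ + V₀(A′ − HD(A′))` ((80) at `J = 0`) is the
LAST term: the V₀-group READ THROUGH THE CHART `T(A′) = A′ − HD(A′)` (47).  Print p. 291 (90) and p. 292 («the other terms are obtained by replacing some A′ … by
−HD(A′)») differentiate it as `(T′(A′))ᵀ((δ∕δA)V₀)(T A′)` with `T′(A′) = 1 − H𝔇(A′)`; g0's files (p584681 … p590049) PROVED the (98)-slot of `(δ∕δA)V₀` read AT `A`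
with a lattice-uniform constant at the flat background.  THIS FILE is the chain rule and the sum, at abstract real inner-product carriers (so that both the scalar
model `BondSpace P` and S1's `TangentBondSU` instantiate it) and at the flat operators `H = hOp (GE D) (QsE D) (EE D)` of every nested family: the gradient of
`A ↦ ½‖∂(A − HD(A))‖² − ½‖∂A‖² + Φ₀(A − HD(A))` at `A′` — Sect. F's `V` for ANY «V₀-functional» `Φ₀` with a gradient `g₀` at `T A′` — IS the vector
`W(A′) = [𝔇†M(DA′ − QA′) − Q†M DA′] + [g₀(TA′) − 𝔇†(H†g₀(TA′))]`, and its pointwise (98)-slot is the sum of brick 6's three-letter slot and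
`(1 + θh₀)·(slot of g₀ at TA′)` — print's «O(1)ε₃²(ε₁ + ε₃)(Lʲη)⁻³» for (90) and «O(1)|∇A′||A′|» for (91)–(96), constants in the letters only.

WHAT IS PROVED (sorry-free; no definition; axioms standard).
* §1 (any real inner-product spaces `E ∋ A′` (fine), `F` (blocks)): `hasFDerivAt_chart47` (`T′(A′) = 1 − H𝔇(A′)` for `T A = A − H(D A)`),
  ★ `hasGradientAt_comp_chart47` (gradient of `Φ₀ ∘ T` at `A′` = `g₀(TA′) − 𝔇†(H†(g₀(TA′)))` — (90) ∕ p. 292 as a Riesz vector),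
  ★★ `hasGradientAt_multiplierForm_add_comp` (THE SUM: gradient of `½⟪D, MD⟫ − ⟪QA, MD⟫ + Φ₀ ∘ T` = `W_H + (g₀∘T − 𝔇†H†g₀∘T)`).
* §2 (`ℓ²`-product carriers, pointwise weights): `compChart47_slot98` (the composed V₀-group's slot: from g₀'s slot `C_V ρ²` at `TA′`, the column letter `h₀` of `H†`
  ((46)ᵀ, fine weight `w₃` → block weight `wB′`) and `θ` of `𝔇(A′)†` ((73)ᵀ): `w₃(b)‖(g₀ − 𝔇†H†g₀)(b)‖ ≤ (1 + θh₀)·C_Vρ²`), ★ `sectF_W_slot98` (the WHOLE: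
  `≤ θO₁(C_Dr² + qr) + q₀O₁C_Dr² + (1 + θh₀)C_Vρ²`; with (57) `ρ ≤ ℓr`, `θ = θ₀r`, `r ≤ a₃` a constant times `r²`).
* §3 at the flat operators of a nested family `D : Domains P`: ★★ `hasGradientAt_sectF_V` — the gradient of
  `A ↦ ½‖∂(A − H(D A))‖² − ½‖∂A‖² + Φ₀(A − H(D A))`, `H = hOp (GE D) (QsE D) (EE D)`, at `A′` is `W_H(A′) + g₀(TA′) − 𝔇†(H†g₀(TA′))` (brick 6 §3 + §1 here;
  `Q`, `M`, `H` read as continuous linear maps displayed by their defining equations); `hasGradientAt_sectF_V_T4` at the record's fine torus.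
HONEST SCOPE.  Calculus and bookkeeping; `Φ₀`∕`g₀` are PARAMETERS (at the 𝔤-valued carrier they are pv27's `V₀` of (26) and g0's transported current — the identification
of carriers is the S1∕S6 junction, not here); the letters `h₀` ((46)ᵀ), `θ` ((73)ᵀ), `C_V` (g0: `(d−1)‖ρ‖(64+138‖τ‖)` at the flat background), `ℓ` ((57)) are
HYPOTHESES; nothing of [15]'s analysis asserted; `stub_prop8StepCoP13` ∕ K0⁷ NOT closed; N07 NOT discharged; counts unmoved (28∕28 · 5∕27); one finite 𝕋⁴ programme at
fixed ε — R4 closes the conditional finite-𝕋⁴ rung `BalabanLadder.UV` only, never the summit; the YM mass gap (Clay) is NOT proved by any of this; nothing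
continuum ∕ ℝ⁴ ∕ OS.  No `sorry`, no `def`, no `instance`, no `notation`.

References: [15] (45)–(47) p.285, (57) p.286, (73) p.289, (80) p.290, (88)–(90) p.291, (91)–(96) p.292, (97)–(98) p.293, (128) p.297, (157)–(158) p.302;
[B6] (2.35) p.228; T. Bałaban, CMP **109** (1987) 249–301 [Balaban1987RG1] (0.1) p.251.
-/

set_option autoImplicit false

noncomputable section

open scoped InnerProductSpace RealInnerProductSpace

namespace Summit.QuantumFields.YangMills.Theorems.K0Stub1SectFGradientAssembly

open Literature.MathematicalPhysics.QuantumFieldTheory.Balaban1983to89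
open Literature.MathematicalPhysics.QuantumFieldTheory.Balaban1983to89.T4Continuum (T4Family)
open Literature.MathematicalPhysics.QuantumFieldTheory.BalabanImbrieJaffe1984to88.BIJ85AxialPropagator411 (BondSpace)
open B6SectADomainsV1 (Domains)
open B6SectAOperatorsV1 (BondIdx BondIdxSpace QE QsE aE dcE)
open B6SectAVectorModelV1 (GE EE)
open B6SectA (hOp)
open Summit.QuantumFields.YangMills.Theorems.K0Stub1SectFHTermsMultiplierForm (hasGradientAt_multiplierForm hasGradientAt_hPart157
  gradMultiplierForm_slot98)

/-! ## §1  The chain rule along the chart (47) and the sum -/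

section Abstract

variable {E F : Type*} [NormedAddCommGroup E] [InnerProductSpace ℝ E] [NormedAddCommGroup F] [InnerProductSpace ℝ F]
variable (H : F →L[ℝ] E) (Dm : E → F)

/-- **`T′(A′) = 1 − H𝔇(A′)`** for the chart `T A = A − H(D A)` of (47), `D` differentiable at `A′` with derivative `𝔇` (print (63): «⟨(δ∕δA′)D(A′), δA′⟩ =
(d∕dτ)D(A′ + τδA′)|₀»). [cite: Balaban1985Variational, (47) p.285, (63) p.287] -/
theorem hasFDerivAt_chart47 {A' : E} {𝔇 : E →L[ℝ] F} (hD : HasFDerivAt Dm 𝔇 A') :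
    HasFDerivAt (fun A => A - H (Dm A)) (ContinuousLinearMap.id ℝ E - H.comp 𝔇) A' :=
  (hasFDerivAt_id A').sub (H.hasFDerivAt.comp A' hD)

/-- ★ **THE COMPOSED V₀-GROUP AS A RIESZ VECTOR** (p. 291 (90), p. 292): if `Φ₀` has gradient `g₀` at `T A′ = A′ − H(D A′)` then `Φ₀ ∘ T` has gradient
`g₀ − 𝔇†(H†g₀)` at `A′` — print's `(1 − 𝔇*(A′)H*)·((δ∕δA)V₀)(A′ − HD(A′))`. [cite: Balaban1985Variational, (90) p.291, (47) p.285] -/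
theorem hasGradientAt_comp_chart47 [CompleteSpace E] [CompleteSpace F] (Φ₀ : E → ℝ) {A' : E} {𝔇 : E →L[ℝ] F} (hD : HasFDerivAt Dm 𝔇 A') {g₀ : E}
    (hΦ : HasGradientAt Φ₀ g₀ (A' - H (Dm A'))) :
    HasGradientAt (fun A => Φ₀ (A - H (Dm A)))
      (g₀ - ContinuousLinearMap.adjoint 𝔇 (ContinuousLinearMap.adjoint H g₀)) A' := by
  rw [hasGradientAt_iff_hasFDerivAt] at hΦ ⊢
  refine (hΦ.comp A' (hasFDerivAt_chart47 H Dm hD)).congr_fderiv ?_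
  ext δ
  simp only [ContinuousLinearMap.comp_apply, sub_apply, ContinuousLinearMap.id_apply, InnerProductSpace.toDual_apply_apply,
    inner_sub_left, inner_sub_right, ContinuousLinearMap.adjoint_inner_left]

/-- ★★ **SECT. F's `W = (δ∕δA′)V` AS ONE GRADIENT VECTOR, ABSTRACTLY**: for continuous linear `Q` (average), `H` (print's `H`), a self-adjoint `M`, a map `D`
with derivative `𝔇` at `A′`, and a «V₀-functional» `Φ₀` with gradient `g₀` at `T A′`: the non-quadratic part of (157) in multiplier form,
`A ↦ ½⟪D A, M D A⟫ − ⟪QA, M D A⟫ + Φ₀(A − H(D A))`, has gradient `[𝔇†M(DA′ − QA′) − Q†M DA′] + [g₀ − 𝔇†(H†g₀)]` at `A′` — the (88)-groups plus the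
(90)–(96)-group of print's `W`. [cite: Balaban1985Variational, (80) p.290, (88)–(90) p.291, (157)–(158) p.302] -/
theorem hasGradientAt_multiplierForm_add_comp [CompleteSpace E] [CompleteSpace F] (Q : E →L[ℝ] F) (M : F →L[ℝ] F)
    (hM : ∀ a b, ⟪M a, b⟫_ℝ = ⟪a, M b⟫_ℝ) (Φ₀ : E → ℝ) {A' : E} {𝔇 : E →L[ℝ] F} (hD : HasFDerivAt Dm 𝔇 A') {g₀ : E}
    (hΦ : HasGradientAt Φ₀ g₀ (A' - H (Dm A'))) :
    HasGradientAt (fun A => 2⁻¹ * ⟪Dm A, M (Dm A)⟫_ℝ - ⟪Q A, M (Dm A)⟫_ℝ + Φ₀ (A - H (Dm A)))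
      ((ContinuousLinearMap.adjoint 𝔇 (M (Dm A' - Q A')) - ContinuousLinearMap.adjoint Q (M (Dm A'))) +
        (g₀ - ContinuousLinearMap.adjoint 𝔇 (ContinuousLinearMap.adjoint H g₀))) A' := by
  have h1 := hasGradientAt_multiplierForm Q M Dm hM hD
  have h2 := hasGradientAt_comp_chart47 H Dm Φ₀ hD hΦ
  rw [hasGradientAt_iff_hasFDerivAt] at h1 h2 ⊢
  rw [map_add]
  exact h1.add h2

end Abstract

/-! ## §2  The pointwise (98)-slot of the composed V₀-group and of the whole `W`, from letters -/

section Slot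

variable {ι β V V' : Type*} [Fintype ι] [Fintype β]
  [NormedAddCommGroup V] [InnerProductSpace ℝ V] [CompleteSpace V] [NormedAddCommGroup V'] [InnerProductSpace ℝ V'] [CompleteSpace V']
variable (H : PiLp 2 (fun _ : β => V') →L[ℝ] PiLp 2 (fun _ : ι => V)) (𝔇 : PiLp 2 (fun _ : ι => V) →L[ℝ] PiLp 2 (fun _ : β => V'))

/-- **THE COMPOSED V₀-GROUP's SLOT FROM LETTERS**: fine weight `w₃ ≥ 0`, block weight `wB′`; LETTERS — g₀'s own slot at the chart point: `w₃(b)‖g₀(b)‖ ≤ C_Vρ²`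
(g0's files at the flat background, `ρ` = size of `TA′`); (46)ᵀ: `H†` maps fine size `s` to block size `h₀s`; (73)ᵀ: `𝔇(A′)†` maps block size `s` to fine size `θs` —;
THEN `w₃(b)‖(g₀ − 𝔇†(H†g₀))(b)‖ ≤ (1 + θh₀)·C_Vρ²`. [cite: Balaban1985Variational, (90) p.291, p.292, (46) p.285, (73) p.289, (98) p.293] -/
theorem compChart47_slot98 (g₀ : PiLp 2 (fun _ : ι => V)) (wB' : β → ℝ) (w₃ : ι → ℝ) (hw₃ : ∀ b, 0 ≤ w₃ b) {CV ρ h₀ θ : ℝ}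
    (hg : ∀ b, w₃ b * ‖g₀ b‖ ≤ CV * ρ ^ 2)
    (h46t : ∀ (Z : PiLp 2 (fun _ : ι => V)) (s : ℝ), (∀ b, w₃ b * ‖Z b‖ ≤ s) → ∀ i, wB' i * ‖ContinuousLinearMap.adjoint H Z i‖ ≤ h₀ * s)
    (h73t : ∀ (X : PiLp 2 (fun _ : β => V')) (s : ℝ), (∀ i, wB' i * ‖X i‖ ≤ s) → ∀ b, w₃ b * ‖ContinuousLinearMap.adjoint 𝔇 X b‖ ≤ θ * s) :
    ∀ b, w₃ b * ‖(g₀ - ContinuousLinearMap.adjoint 𝔇 (ContinuousLinearMap.adjoint H g₀)) b‖ ≤ (1 + θ * h₀) * (CV * ρ ^ 2) := by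
  intro b
  have hT := h73t _ _ (h46t g₀ _ hg) b
  rw [PiLp.sub_apply]
  calc w₃ b * ‖g₀ b - ContinuousLinearMap.adjoint 𝔇 (ContinuousLinearMap.adjoint H g₀) b‖
      ≤ w₃ b * (‖g₀ b‖ + ‖ContinuousLinearMap.adjoint 𝔇 (ContinuousLinearMap.adjoint H g₀) b‖) :=
        mul_le_mul_of_nonneg_left (norm_sub_le _ _) (hw₃ b)
    _ = w₃ b * ‖g₀ b‖ + w₃ b * ‖ContinuousLinearMap.adjoint 𝔇 (ContinuousLinearMap.adjoint H g₀) b‖ := mul_add _ _ _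
    _ ≤ CV * ρ ^ 2 + θ * (h₀ * (CV * ρ ^ 2)) := add_le_add (hg b) hT
    _ = (1 + θ * h₀) * (CV * ρ ^ 2) := by ring

variable (Q : PiLp 2 (fun _ : ι => V) →L[ℝ] PiLp 2 (fun _ : β => V')) (M : PiLp 2 (fun _ : β => V') →L[ℝ] PiLp 2 (fun _ : β => V'))
  (Dm : PiLp 2 (fun _ : ι => V) → PiLp 2 (fun _ : β => V'))

/-- ★ **THE POINTWISE (98)-SLOT OF THE WHOLE `W = (δ∕δA′)V` OF SECT. F FROM THE PRINTED LETTERS**: brick 6's three-letter slot for the `H`-groups ((3.132) `O₁`,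
`Q†`'s `q₀`, (73)ᵀ `θ`, (55) `C_Dr²`, the average `qr`) plus the composed V₀-group's (`C_Vρ²` at the chart point, (46)ᵀ `h₀`, (73)ᵀ `θ`):
`w₃(b)‖W(A′)(b)‖ ≤ θO₁(C_Dr² + qr) + q₀O₁C_Dr² + (1 + θh₀)C_Vρ²` — with (57) `ρ ≤ ℓr`, (73) `θ = θ₀r` and `r ≤ a₃` a constant IN THE LETTERS times `r²`
(print's «C₄ depends on d and L only» is then the statement that the letters do). [cite: Balaban1985Variational, (97)–(98) p.293, (88)–(90) p.291, (57) p.286] -/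
theorem sectF_W_slot98 (A' : PiLp 2 (fun _ : ι => V)) (g₀ : PiLp 2 (fun _ : ι => V)) (wB wB' : β → ℝ) (w₃ : ι → ℝ) (hwB : ∀ i, 0 ≤ wB i)
    (hw₃ : ∀ b, 0 ≤ w₃ b) {O₁ q₀ θ CD q r CV ρ h₀ : ℝ}
    (h3132 : ∀ (X : PiLp 2 (fun _ : β => V')) (s : ℝ), (∀ i, wB i * ‖X i‖ ≤ s) → ∀ i, wB' i * ‖M X i‖ ≤ O₁ * s)
    (hQt : ∀ (X : PiLp 2 (fun _ : β => V')) (s : ℝ), (∀ i, wB' i * ‖X i‖ ≤ s) → ∀ b, w₃ b * ‖ContinuousLinearMap.adjoint Q X b‖ ≤ q₀ * s)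
    (h73t : ∀ (X : PiLp 2 (fun _ : β => V')) (s : ℝ), (∀ i, wB' i * ‖X i‖ ≤ s) → ∀ b, w₃ b * ‖ContinuousLinearMap.adjoint 𝔇 X b‖ ≤ θ * s)
    (h55 : ∀ i, wB i * ‖Dm A' i‖ ≤ CD * r ^ 2) (hQ : ∀ i, wB i * ‖Q A' i‖ ≤ q * r)
    (hg : ∀ b, w₃ b * ‖g₀ b‖ ≤ CV * ρ ^ 2)
    (h46t : ∀ (Z : PiLp 2 (fun _ : ι => V)) (s : ℝ), (∀ b, w₃ b * ‖Z b‖ ≤ s) → ∀ i, wB' i * ‖ContinuousLinearMap.adjoint H Z i‖ ≤ h₀ * s) :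
    ∀ b, w₃ b * ‖((ContinuousLinearMap.adjoint 𝔇 (M (Dm A' - Q A')) - ContinuousLinearMap.adjoint Q (M (Dm A'))) +
        (g₀ - ContinuousLinearMap.adjoint 𝔇 (ContinuousLinearMap.adjoint H g₀))) b‖
      ≤ θ * (O₁ * (CD * r ^ 2 + q * r)) + q₀ * (O₁ * (CD * r ^ 2)) + (1 + θ * h₀) * (CV * ρ ^ 2) := by
  intro b
  have h1 := gradMultiplierForm_slot98 Q M Dm 𝔇 A' wB wB' w₃ hwB hw₃ h3132 hQt h73t h55 hQ b
  have h2 := compChart47_slot98 H 𝔇 g₀ wB' w₃ hw₃ hg h46t h73t b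
  rw [PiLp.add_apply]
  calc w₃ b * ‖(ContinuousLinearMap.adjoint 𝔇 (M (Dm A' - Q A')) - ContinuousLinearMap.adjoint Q (M (Dm A'))) b +
          (g₀ - ContinuousLinearMap.adjoint 𝔇 (ContinuousLinearMap.adjoint H g₀)) b‖
      ≤ w₃ b * (‖(ContinuousLinearMap.adjoint 𝔇 (M (Dm A' - Q A')) - ContinuousLinearMap.adjoint Q (M (Dm A'))) b‖ +
          ‖(g₀ - ContinuousLinearMap.adjoint 𝔇 (ContinuousLinearMap.adjoint H g₀)) b‖) :=
        mul_le_mul_of_nonneg_left (norm_add_le _ _) (hw₃ b)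
    _ ≤ _ := by rw [mul_add]; exact add_le_add h1 h2

end Slot

/-! ## §3  At the flat operators of a nested family, and at the record -/

section AtObjects

variable {P : Params} (D : Domains P) {c : ℝ} (hc : c ≠ 0) {w : BondIdx D → ℝ} (hw : ∀ i, 0 < w i)

/-- ★★ **SECT. F's `W = (δ∕δA′)V` AS ONE GRADIENT VECTOR AT THE RECORD's FLAT OPERATORS**: for ANY nested family `D`, ANY block-data map `D(·)` differentiable at `A′`
(derivative `𝔇`), ANY «V₀-functional» `Φ₀` with a gradient `g₀` at the chart point `TA′ = A′ − H(D A′)`, and `Q`, `M`, `Hc` the continuous linear readings of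
`QE D`, `EE D − aE D w`, `hOp (GE D) (QsE D) (EE D)` (displayed by their defining equations): the non-quadratic part of Sect. F's functional (157) in the chart,
`A ↦ ½‖∂(A − H(D A))‖² − ½‖∂A‖² + Φ₀(A − H(D A))`, has GRADIENT `[𝔇†M(DA′ − QA′) − Q†M DA′] + [g₀ − 𝔇†(Hc†g₀)]` at `A′` — the vector `W A′` of k0-s1-w1's
(128) `⟪δ, Δ_aA′ + W A′⟫ = 0` (brick 6 `hasGradientAt_hPart157` + §1). [cite: Balaban1985Variational, (157)–(158) p.302, (80) p.290, (88)–(90) p.291, (128) p.297] -/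
theorem hasGradientAt_sectF_V (Qc : BondSpace P →L[ℝ] BondIdxSpace D) (hQc : ∀ A, Qc A = QE D A)
    (Mc : BondIdxSpace D →L[ℝ] BondIdxSpace D) (hMc : ∀ X, Mc X = EE D hc hw X - aE D w X)
    (Hc : BondIdxSpace D →L[ℝ] BondSpace P) (hHc : ∀ X, Hc X = hOp (GE D hc hw) (QsE D) (EE D hc hw) X)
    (Dm : BondSpace P → BondIdxSpace D) {A' : BondSpace P} {𝔇 : BondSpace P →L[ℝ] BondIdxSpace D} (hD : HasFDerivAt Dm 𝔇 A')
    (Φ₀ : BondSpace P → ℝ) {g₀ : BondSpace P} (hΦ : HasGradientAt Φ₀ g₀ (A' - Hc (Dm A'))) :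
    HasGradientAt (fun A => ‖dcE c (A - hOp (GE D hc hw) (QsE D) (EE D hc hw) (Dm A))‖ ^ 2 / 2 - ‖dcE c A‖ ^ 2 / 2
        + Φ₀ (A - hOp (GE D hc hw) (QsE D) (EE D hc hw) (Dm A)))
      ((ContinuousLinearMap.adjoint 𝔇 (Mc (Dm A' - Qc A')) - ContinuousLinearMap.adjoint Qc (Mc (Dm A'))) +
        (g₀ - ContinuousLinearMap.adjoint 𝔇 (ContinuousLinearMap.adjoint Hc g₀))) A' := by
  have h1 := hasGradientAt_hPart157 D hc hw Qc hQc Mc hMc Dm hD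
  have e : (fun A => Φ₀ (A - hOp (GE D hc hw) (QsE D) (EE D hc hw) (Dm A))) = fun A => Φ₀ (A - Hc (Dm A)) := by
    funext A; rw [hHc]
  have h2 : HasGradientAt (fun A => Φ₀ (A - hOp (GE D hc hw) (QsE D) (EE D hc hw) (Dm A)))
      (g₀ - ContinuousLinearMap.adjoint 𝔇 (ContinuousLinearMap.adjoint Hc g₀)) A' := by
    rw [e]; exact hasGradientAt_comp_chart47 Hc Dm Φ₀ hD hΦ
  rw [hasGradientAt_iff_hasFDerivAt] at h1 h2 ⊢
  rw [map_add]
  exact h1.add h2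

/-- ★★ at the record's fine torus `Site (F.P K) 0` of a `T4Family` member (`hasGradientAt_sectF_V` at `P := F.P K`, any nested family there).
[cite: Balaban1985Variational, (157)–(158) p.302; Balaban1987RG1, (0.1) p.251] -/
theorem hasGradientAt_sectF_V_T4 (F : T4Family) (K : ℕ) (D : Domains (F.P K)) {c : ℝ} (hc : c ≠ 0) {w : BondIdx D → ℝ} (hw : ∀ i, 0 < w i)
    (Qc : BondSpace (F.P K) →L[ℝ] BondIdxSpace D) (hQc : ∀ A, Qc A = QE D A)
    (Mc : BondIdxSpace D →L[ℝ] BondIdxSpace D) (hMc : ∀ X, Mc X = EE D hc hw X - aE D w X)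
    (Hc : BondIdxSpace D →L[ℝ] BondSpace (F.P K)) (hHc : ∀ X, Hc X = hOp (GE D hc hw) (QsE D) (EE D hc hw) X)
    (Dm : BondSpace (F.P K) → BondIdxSpace D) {A' : BondSpace (F.P K)} {𝔇 : BondSpace (F.P K) →L[ℝ] BondIdxSpace D} (hD : HasFDerivAt Dm 𝔇 A')
    (Φ₀ : BondSpace (F.P K) → ℝ) {g₀ : BondSpace (F.P K)} (hΦ : HasGradientAt Φ₀ g₀ (A' - Hc (Dm A'))) :
    HasGradientAt (fun A => ‖dcE c (A - hOp (GE D hc hw) (QsE D) (EE D hc hw) (Dm A))‖ ^ 2 / 2 - ‖dcE c A‖ ^ 2 / 2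
        + Φ₀ (A - hOp (GE D hc hw) (QsE D) (EE D hc hw) (Dm A)))
      ((ContinuousLinearMap.adjoint 𝔇 (Mc (Dm A' - Qc A')) - ContinuousLinearMap.adjoint Qc (Mc (Dm A'))) +
        (g₀ - ContinuousLinearMap.adjoint 𝔇 (ContinuousLinearMap.adjoint Hc g₀))) A' :=
  hasGradientAt_sectF_V D hc hw Qc hQc Mc hMc Hc hHc Dm hD Φ₀ hΦ

end AtObjects

end Summit.QuantumFields.YangMills.Theorems.K0Stub1SectFGradientAssembly

end
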